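import Summits.QuantumFields.YangMills.Theorems.BalabanUVNodesN08AlphaEq324RowACReMassed
import Summits.QuantumFields.YangMills.Theorems.BalabanUVNodesN08ReMassedACLeaves

/-!
# Route «BalabanUVNodes», Track-A DAG node N08 = [Balaban1985UV3] Thm 1 p. 257 ∕ Thm 2 p. 272 — THE RE-MASSED AC TOWER READ FROM THE EDITED (α)-AC CLAUSE, part 2:
# the fourteen step leaves, THEOREM 2, row B25 and the whole analytic bundle at the re-massed tower from `…RowAC.RunAlphaEq324CoreLTAtAC` (the (3.24) row in print's
# output-sandwich currency at ANY cumulant letter, range-honest bundle) + the `W′`-hypotheses (dag-n08-w1 g4's II §2–§3 ∕ III-a re-entered one (α)-currency lower)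

Cell `pub-ymgap`, seat `pub-ymgap-dag-n08-w4` gen 4 (INTENT-3, file 2; sequel of `…RowACReMassed`).  `bears_on: R4∕N08`; `--supports stmt-QuantumFields-20542` (K1⁷, helper).
THEOREMS ONLY (def-free), sorry-free, standard axioms; dag-n08-w1's I-a∕I-b∕II∕III-a and the lane's `Balaban3D/Proofs/*AC` modules consumed BY NAME, untouched.

WHAT THIS FILE PROVES (every proof = dag-n08-w1's with the (α)-AC step input `StepAlphaAC` replaced by the edited step list `StepAlphaEq324CoreLTAtAC … c k hk`: C1∕C2 and the
mass-free leaves from part 1, the (63)∕(45) binders read on the run's steps only, (25) at the chart centre from p608282's `bound25_vac_coreLTAtAC`, B15 from p608282's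
`bound46_towerOfAC_of_coreLTAtAC`):
* §1 ★★ `exists_stepLeaves_reMassed_of_coreLTAtAC` (the fourteen step leaves at the re-massed tower, pieces pinned) · ★★★ `ineq41_47_reMassed_of_coreLTAtAC` — BAŁABAN CMP 102
  THEOREM 2 ((41) ∧ (47), every `k ≤ K`) FOR THE RE-MASSED TOWER from the edition + the four `W′`-hypotheses.
* §2 ★★ `lf_reMassed_of_coreLTAtAC` (B25 POINTWISE at the re-massed tower under the pointwise cap `W′ ≤ e^{c_m|T₁^{(k)}|}`; rows (67)∘LF and (68) of the edition) · `bound46_normal_of_coreLTAtAC`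
  · ★ `bound46_reMassed_of_coreLTAtAC` · ★★★ `nonempty_analyticLeaves_reMassed_of_coreLTAtAC` (`UVStability3D.AnalyticLeaves C′ S T′` at the re-massed tower, `C′ = {consts with
  d := d + c_m}`, from the edition + the five `W′`-hypotheses).
HONEST FRAMING: count-neutral helper; the edited (α)-AC rows and the `W′`-hypotheses are HYPOTHESES (N08's object gap in AC currency); `PrintedUV3V` NOT proved here; N08 NOT
discharged; one finite 𝕋⁴ programme at fixed ε, Bałaban AS PRINTED — R4 closes the conditional finite-𝕋⁴ rung `BalabanLadder.UV` only; the Yang–Mills mass gap (Clay) is NOT proved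
by any of this; nothing continuum ∕ ℝ⁴ ∕ OS.

References: [Balaban1985UV3] T. Bałaban, Commun. Math. Phys. 102 (1985) 255–275 — Thm 2 p. 272, (1) p. 256, (41) p. 266, (44)–(47) p. 267, (55)–(63) pp. 269–272, (65)–(68)
p. 273, pp. 273–274; [Balaban1982Higgs1] (3.24) p. 616.
-/

noncomputable section

open MeasureTheory

namespace Summit.QuantumFields.YangMills.Theorems.BalabanUVNodesN08AlphaEq324RowACReMassedSlot

open scoped Matrix.Norms.L2Operator
open Literature.MathematicalPhysics.QuantumFieldTheory.Balaban1983to89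
open Literature.MathematicalPhysics.QuantumFieldTheory.Balaban1983to89.B10
open Literature.MathematicalPhysics.QuantumFieldTheory.Balaban1983to89.B10SectAGathering
open Literature.MathematicalPhysics.QuantumFieldTheory.Balaban1985CMP102
open Literature.MathematicalPhysics.QuantumFieldTheory.Balaban1985CMP102.Setting
open Literature.MathematicalPhysics.QuantumFieldTheory.Balaban1985CMP102.SectB (TowerObjects)
open Summit.QuantumFields.Balaban3D
open Summit.QuantumFields.Balaban3D.Carriers
open Summit.QuantumFields.Balaban3D.Proofs
open Summit.QuantumFields.Balaban3D.Proofs.ScalesArithmetic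
open Summit.QuantumFields.Balaban3D.Proofs.Constants (consts3_d_eq_log)
open Summit.QuantumFields.Balaban3D.Proofs.FamilyLE (thresholds_of_le)
open Summit.QuantumFields.Balaban3D.Proofs.Family (prov_hb₁ prov_hb₂)
open Summit.QuantumFields.Balaban3D.Proofs.GroupModelLieC (lieC)
open Summit.QuantumFields.Balaban3D.Proofs.TowerAC
open Summit.QuantumFields.Balaban3D.Proofs.SeriesAC
open Summit.QuantumFields.Balaban3D.Proofs.StandardAC
open Summit.QuantumFields.Balaban3D.Proofs.InputsAC
open Summit.QuantumFields.Balaban3D.Proofs.MassesAC (massRecAC)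
open Summit.QuantumFields.Balaban3D.Proofs.AlphaAC (AlphaDataAC StepAlphaAC RunAlphaAC)
open Summit.QuantumFields.Balaban3D.Proofs.Thresholds (gamma71L)
open Summit.QuantumFields.Balaban3D.Proofs.LiftBridge (liftCfg)
open Summit.QuantumFields.Balaban3D.Proofs.Run3SmallFactors (codeZ)
open Summit.QuantumFields.YangMills.BalabanUVNodes.N08SlotOfRecordFromAlphaACMassBound (lf_towerAC3_of_massBound)
open Summit.QuantumFields.YangMills.BalabanUVNodes.N08SeriesACStepBounds
open Summit.QuantumFields.YangMills.BalabanUVNodes.N08ReMassedACStepBounds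
open Summit.QuantumFields.YangMills.BalabanUVNodes.N08ReMassedACThm2 (starCount_reMassed ztermSucc_reMassed rmSucc_reMassed step0_reMassed)
open Summit.QuantumFields.YangMills.BalabanUVNodes.N08ReMassedACLeaves (inputOfAC_Pint inputOfAC_M₁ inputOfAC_Rcol inputOfAC_b₀ inputOfAC_p₀ usesConsts_reMassed)
open Summit.QuantumFields.YangMills.Theorems.BalabanUVNodesN08AlphaEq324RowAC
open Summit.QuantumFields.YangMills.Theorems.BalabanUVNodesN08AlphaEq324RowACEnd (bound25_vac_coreLTAtAC bound46_towerOfAC_of_coreLTAtAC)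
open Summit.QuantumFields.YangMills.Theorems.BalabanUVNodesN08AlphaEq324RowACReMassed
open B7Prop1Explicit (hol plaqWord)
open B7Prop1Local (pdevOn loK plaqHiK)
open B7Prop2Explicit (avgIter)
open B10LargeField (xlog)

variable {L : ℕ} {S : Scales L} {G : Type} [GaugeGroup G] [MeasurableSpace G] [HaarData G]
  {𝔊 : GroupModel G} {𝔠 : Primitives.AlphaConsts L 𝔊.N} {X : ExternalInputsAC S G}
  {𝔖 : ∀ k, StepSeries S G ↥(lieC 𝔊) (nblkOf S 𝔠.lane.carrier k) k} {𝔄 : AlphaDataLTAC 𝔊 𝔠 X 𝔖}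
  {c : ∀ k, Hist S.P (k + 1) → GaugeField S.P (k + 1) G → ℕ → ℝ}
  (hfam : S.g ^ 2 * S.ε₀ ≤ (min 𝔠.gamma0 1) ^ 2)
  (W' : HistWeightsAC S.P G) (B' : TowerBaseAC S G) (hB' : B' = { X.toTowerBase 𝔠.lane.carrier with W := W' })
  (hae : ∀ j, j ≤ S.K → ∀ h : Hist S.P j, W'.mass j h =ᵐ[fieldMeasure S.P j G]
    massRecAC 𝔠.lane.carrier.M₁ (rcolOf S 𝔠.lane.carrier) (eps1Of S 𝔠.lane.carrier) (epsSOf S 𝔠.lane.carrier) X.av j h)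
  (hdom : ∀ (j : ℕ) (h : Hist S.P j) (U : GaugeField S.P j G),
    W'.mass j h U ≤ massRecAC 𝔠.lane.carrier.M₁ (rcolOf S 𝔠.lane.carrier) (eps1Of S 𝔠.lane.carrier) (epsSOf S 𝔠.lane.carrier) X.av j h U)
  (hWm : ∀ (j : ℕ) (h : Hist S.P j), Measurable (W'.mass j h)) (hmt : ∀ (j : ℕ) (U : GaugeField S.P j G), 1 ≤ W'.mass j (Hist.triv S.P j) U)
  {cm : ℝ} (hcm : 0 ≤ cm) (hcap : ∀ k, 1 ≤ k → k ≤ S.K → ∀ (h : Hist S.P k) (U : GaugeField S.P k G), W'.mass k h U ≤ Real.exp (cm * S.sites k))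

/-! ## §1 The fourteen step leaves and Theorem 2 for the re-massed tower from the edition -/

include hfam hB' hae hdom hWm hmt in
/-- ★★ **THE FOURTEEN STEP LEAVES OF STEP `k → k+1` AT THE RE-MASSED TOWER, PIECES PINNED, FROM THE EDITED (α)-AC STEP LIST** at an arbitrary letter `c` (range-honest `𝔄`) on the
`≤`-family + the four `W′`-hypotheses: C1∕C2 and C3–C8∕C10 from part 1, C9∕C11–C14 dag-n08-w1's bookkeeping leaves BY NAME, `c₁ := 3`. [cite: Balaban1985UV3, (55)–(62) pp.269–271 + p.272] -/
theorem exists_stepLeaves_reMassed_of_coreLTAtAC {k : ℕ} (hk : k + 1 ≤ S.K) (A : StepAlphaEq324CoreLTAtAC 𝔊 𝔠 X 𝔖 𝔄 c k hk) :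
    ∃ Λ : StepLeaves (B'.withSeriesAC 𝔖 (piecesParamsOf S 𝔠.lane.carrier)).tower3.toTowerRun k, Λ.P = B'.seriesPiecesAC 𝔖 (piecesParamsOf S 𝔠.lane.carrier) k :=
  ⟨{ P := B'.seriesPiecesAC 𝔖 (piecesParamsOf S 𝔠.lane.carrier) k
     Cz := 𝔠.lane.sc.Cz, C₁ := 𝔠.lane.sc.C₁, C₁' := 𝔠.lane.sc.C₁', C₂ := 𝔠.lane.sc.C₂, Cv := 𝔠.lane.sc.Cv, C₃ := 𝔠.lane.sc.C₃,
     C₄ := 𝔠.lane.sc.C₄, C₅ := 𝔠.lane.sc.C₅, c₁ := 3, C₆ := 𝔠.lane.sc.C₆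
     bound55 := bound55_reMassed_of_coreLTAtAC W' hae hdom hWm hmt B' hB' hk A
     bound55Lower := bound55Lower_reMassed_of_coreLTAtAC W' B' hB' A
     cumulant58 := cumulant58_reMassed_of_coreLTAtAC W' B' hB' hfam hk A
     cumulantLower := cumulantLower_reMassed_of_coreLTAtAC W' B' hB' hfam hk A
     repr33_60 := repr33_60_reMassed_of_coreLTAtAC W' B' hB' hfam hk A
     vacuumWhole := vacuumWhole_reMassed_of_coreLTAtAC W' B' hB' hk A
     decomp35_61 := decomp35_61_reMassed_of_coreLTAtAC W' B' hB' hfam hk A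
     norm35 := norm35_reMassed_of_coreLTAtAC W' B' hB' A
     starCount := starCount_reMassed W' B' hB' hk
     oldOutside := oldOutside_reMassed_of_coreLTAtAC W' B' hB' hfam hk A
     pintSucc := B'.pintSucc_seriesAC 𝔖 (piecesParamsOf S 𝔠.lane.carrier) k
     estep62 := B'.estep62_seriesAC 𝔖 (piecesParamsOf S 𝔠.lane.carrier) k
     ztermSucc := ztermSucc_reMassed W' B' hB' k
     rmSucc := rmSucc_reMassed W' B' hB' k }, rfl⟩

include hfam hB' hae hdom hWm hmt in
/-- ★★★ **BAŁABAN CMP 102 THEOREM 2 FOR THE RE-MASSED TOWER FROM THE EDITED (α)-AC CLAUSE AT AN ARBITRARY CUMULANT LETTER** on the `≤`-family `g²ε₀ ≤ (min γ₀ 1)²`: if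
`RunAlphaEq324CoreLTAtAC 𝔊 𝔠 X 𝔖 𝔄 c` holds (the (3.24) row as the printed sandwich `Eq324` at `c`, range-honest bundle) and `W′` agrees `dU`-a.e. with print's `massRecAC` (levels
`≤ K`), is dominated by it, measurable and `≥ 1` at the trivial history, then the R-RN-selected densities of the re-massed tower satisfy (41) p. 266 and (47) p. 267 for every
`k ≤ K` (dag-n08-w1's `ineq41_47_reMassed`, one (α)-currency lower). [cite: Balaban1985UV3, Thm 2 p.272 + (41) p.266 + (47) p.267; Balaban1982Higgs1, (3.24) p.616] -/
theorem ineq41_47_reMassed_of_coreLTAtAC (R : RunAlphaEq324CoreLTAtAC 𝔊 𝔠 X 𝔖 𝔄 c) (k : ℕ) (hk : k ≤ S.K) :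
    Ineq41 (B'.withSeriesAC 𝔖 (piecesParamsOf S 𝔠.lane.carrier)).tower3.toTowerRun k ∧
      Ineq47 (B'.withSeriesAC 𝔖 (piecesParamsOf S 𝔠.lane.carrier)).tower3.toTowerRun k := by
  have h2 := thm2_of_leaves (I := Unit) (fun _ => (B'.withSeriesAC 𝔖 (piecesParamsOf S 𝔠.lane.carrier)).tower3.toTowerRun)
    (fun _ => TowerObjects.specOK_pin ((B'.withSeriesAC 𝔖 (piecesParamsOf S 𝔠.lane.carrier)).towerWith fun _ => True))
    (fun _ => step0_reMassed W' B' hB' (𝔖 := 𝔖))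
    (fun _ j hj => ⟨gk_pos S j, gk_le_one S S.gK_le_one j (by have hj' : j + 1 ≤ S.K := hj; omega)⟩)
    (fun _ j hj => (exists_stepLeaves_reMassed_of_coreLTAtAC hfam W' B' hB' hae hdom hWm hmt hj (R.steps j hj)).choose)
  exact (TowerObjects.specOK_pin ((B'.withSeriesAC 𝔖 (piecesParamsOf S 𝔠.lane.carrier)).towerWith fun _ => True) k).mp (h2 () k hk)

/-! ## §2 Row B25, (46) and the whole analytic bundle at the re-massed tower from the edition -/

include hfam hB' hdom hcm hcap in
/-- ★★ **ROW B25 POINTWISE AT THE RE-MASSED TOWER FROM THE EDITION's rows (67)∘LF ∕ (68)** and the cap on `W′` (dag-n08-w1's `lf_reMassed` with `R.hLF67 R.h68` read from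
`RunAlphaEq324CoreLTAtAC`). [cite: Balaban1985UV3, pp.273–274 + (67)–(68) p.273 + (39)–(41) p.266 + (7) p.257] -/
theorem lf_reMassed_of_coreLTAtAC (R : RunAlphaEq324CoreLTAtAC 𝔊 𝔠 X 𝔖 𝔄 c) :
    ∀ k, k ≤ (B'.withSeriesAC 𝔖 (piecesParamsOf S 𝔠.lane.carrier)).tower3.toTowerRun.K →
      ∀ U : (B'.withSeriesAC 𝔖 (piecesParamsOf S 𝔠.lane.carrier)).tower3.toTowerRun.Cfg k,
      (B'.withSeriesAC 𝔖 (piecesParamsOf S 𝔠.lane.carrier)).tower3.toTowerRun.LF k U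
          (fun h => -((B'.withSeriesAC 𝔖 (piecesParamsOf S 𝔠.lane.carrier)).tower3.toTowerRun.mainT k h U)
            + (B'.withSeriesAC 𝔖 (piecesParamsOf S 𝔠.lane.carrier)).tower3.toTowerRun.Zterm k h)
        ≤ Real.exp ((𝔠.lane.consts.d + cm) * (B'.withSeriesAC 𝔖 (piecesParamsOf S 𝔠.lane.carrier)).tower3.toTowerRun.sites k) := by
  subst hB'
  have hr₀ : 0 ≤ 𝔠.lane.carrier.r₀ := le_trans zero_le_one 𝔠.one_le_r₀
  have hCz : 0 ≤ 𝔠.lane.carrier.Cz + 𝔠.lane.carrier.Cv := add_nonneg 𝔠.Cz_nonneg 𝔠.Cv_nonneg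
  have hc₁ : 0 ≤ 𝔠.lane.carrier.c₁ := by show (0 : ℝ) ≤ 3; norm_num
  have hA : 0 ≤ (𝔠.lane.carrier.Cz + 𝔠.lane.carrier.Cv) + 𝔠.lane.carrier.C₅ + 𝔠.lane.carrier.C₆ +
      (|𝔠.lane.carrier.logσ₀| + 𝔠.lane.carrier.dg) * 𝔠.lane.carrier.c₁ := by
    have := 𝔠.lane.carrier.dg_nonneg
    have := abs_nonneg 𝔠.lane.carrier.logσ₀
    have h5 : 0 ≤ 𝔠.lane.carrier.C₅ := 𝔠.C₅_nonneg
    have h6 : 0 ≤ 𝔠.lane.carrier.C₆ := 𝔠.C₆_nonneg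
    positivity
  have hρ : (0 : ℝ) ≤ (𝔠.lane.carrier.R₁ + 1) * 𝔠.lane.carrier.M₁ := by
    have : 0 ≤ 𝔠.lane.carrier.R₁ := 𝔠.R₁_nonneg
    positivity
  exact lf_towerAC3_of_massBound 𝔊 𝔠.lane.consts (consts3_d_eq_log 𝔠.lane.F 𝔠.lane.sc) rfl S.hL.2
    (({ X.toTowerBase 𝔠.lane.carrier with W := W' } : TowerBaseAC S G).withSeriesAC 𝔖 (piecesParamsOf S 𝔠.lane.carrier)) (gs := 1) (ε := S.g0sq)
    (fun k hk => by exact_mod_cast sites_eq_card S k (by omega))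
    (fun k h U hh => reMassed_mass_eq_zero_of_not_admissible W' hdom k h U hh)
    hcm hcap (g0sq_pos S) 𝔠.C68_pos 𝔠.lane.F.b₀_pos 𝔠.lane.F.p₀_pos
    (fun j => by rw [show 𝔠.lane.consts.g = 1 from rfl, show 𝔠.lane.consts.L = (L : ℝ) from rfl]; exact gk_eq_gRun_norm S j)
    (fun j hj => (thresholds_of_le hfam j hj.le).2.2.2.1) R.hLF67 R.h68 𝔠.lane.F.M₁_pos
    (LargeFieldStd.rcolOf_antitone 𝔠.lane.carrier 𝔠.R₁_nonneg hr₀) hρ hr₀ (LargeFieldStd.rcolOf_le 𝔠.lane.carrier 𝔠.R₁_nonneg hr₀)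
    (LargeFieldStd.zcoefOf_nonneg 𝔠.lane.carrier hCz 𝔠.C₅_nonneg 𝔠.C₆_nonneg hc₁)
    (LargeFieldStd.zcoefOf_le 𝔠.lane.carrier hCz 𝔠.C₅_nonneg 𝔠.C₆_nonneg hc₁) hA
    (fun j hj => ⟨gk_pos S j, gk_le_one S S.gK_le_one j hj⟩) le_rfl 𝔠.prov_r₀p₀ (prov_hb₁ 𝔠 𝔊.N_pos) (prov_hb₂ 𝔠 𝔊.N_pos)

omit hB' in
include hfam in
/-- **(46) IN NORMAL FORM from the edited (α)-AC rows** (p608282's `bound46_towerOfAC_of_coreLTAtAC` — the range-honest binders `𝔄.Λc`∕`𝔄.N45` on `k < K` — unfolded to the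
interaction sum `pintOfSeries`, the carrier's `M₁`, `b₀`, `p₀`, `Rcol`, the running coupling and `min |Λ_k| |T₁^{(k)}|`, as dag-n08-w1's `bound46_normal_of_alphaAC`).
[cite: Balaban1985UV3, (44)–(46) p.267] -/
theorem bound46_normal_of_coreLTAtAC (R : RunAlphaEq324CoreLTAtAC 𝔊 𝔠 X 𝔖 𝔄 c) :
    ∀ k, 1 ≤ k → k ≤ S.K → ∀ (h : Hist S.P k) (U : GaugeField S.P k G),
      |pintOfSeries 𝔠.lane.carrier.M₁ (rcolOf S 𝔠.lane.carrier) 𝔖 k h U| ≤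
        𝔠.lane.consts.C46 * ((𝔠.lane.carrier.M₁ : ℕ) : ℝ) ^ 3 * (S.gk (k - 1) ^ 2 * pFun 𝔠.lane.carrier.b₀ 𝔠.lane.carrier.p₀ (S.gk (k - 1)) ^ 2) *
          min ((LamVol 𝔠.lane.carrier.M₁ (rcolOf S 𝔠.lane.carrier) k h : ℕ) : ℝ) (S.sites k) := by
  intro k hk1 hkK h U
  have h46 := bound46_towerOfAC_of_coreLTAtAC hfam R k hk1 hkK h U
  simp only [tower3_Pint, tower3_M₁, tower3_g, tower3_b₀, tower3_p₀, tower3_Λvol, inputOfAC_Pint, inputOfAC_M₁, inputOfAC_Rcol, inputOfAC_b₀, inputOfAC_p₀] at h46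
  exact h46

include hfam hB' in
/-- ★ **(46) AT THE RE-MASSED TOWER from the edited (α)-AC rows** in the shape of `UVStability3D.AnalyticLeaves.bound46` (dag-n08-w1's `bound46_reMassed`, one (α)-currency lower).
[cite: Balaban1985UV3, (44)–(46) p.267] -/
theorem bound46_reMassed_of_coreLTAtAC (R : RunAlphaEq324CoreLTAtAC 𝔊 𝔠 X 𝔖 𝔄 c) :
    ∀ k, 1 ≤ k → k ≤ (B'.withSeriesAC 𝔖 (piecesParamsOf S 𝔠.lane.carrier)).tower3.toTowerRun.K →
      ∀ (h : (B'.withSeriesAC 𝔖 (piecesParamsOf S 𝔠.lane.carrier)).tower3.toTowerRun.Hist k)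
        (U : (B'.withSeriesAC 𝔖 (piecesParamsOf S 𝔠.lane.carrier)).tower3.toTowerRun.Cfg k),
      |(B'.withSeriesAC 𝔖 (piecesParamsOf S 𝔠.lane.carrier)).tower3.toTowerRun.Pint k h U| ≤
        𝔠.lane.consts.C46 * (B'.withSeriesAC 𝔖 (piecesParamsOf S 𝔠.lane.carrier)).tower3.toTowerRun.M₁ ^ 3
        * (((B'.withSeriesAC 𝔖 (piecesParamsOf S 𝔠.lane.carrier)).tower3.toTowerRun.g (k - 1)) ^ 2
          * (pFun (B'.withSeriesAC 𝔖 (piecesParamsOf S 𝔠.lane.carrier)).tower3.toTowerRun.b₀ (B'.withSeriesAC 𝔖 (piecesParamsOf S 𝔠.lane.carrier)).tower3.toTowerRun.p₀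
            ((B'.withSeriesAC 𝔖 (piecesParamsOf S 𝔠.lane.carrier)).tower3.toTowerRun.g (k - 1))) ^ 2)
        * (B'.withSeriesAC 𝔖 (piecesParamsOf S 𝔠.lane.carrier)).tower3.toTowerRun.Λvol k h := by
  subst hB'
  exact fun k hk1 hkK h U => bound46_normal_of_coreLTAtAC hfam R k hk1 hkK h U

include hfam hB' hae hdom hWm hmt hcm hcap in
open Classical in
/-- ★★★ **`UVStability3D.AnalyticLeaves C′ S T′` AT THE RE-MASSED TOWER `T′`, `C′ = {𝔠.lane.consts with d := d + c_m}`, FROM THE EDITED (α)-AC CLAUSE AND THE FIVE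
`W′`-HYPOTHESES** (dag-n08-w1's `nonempty_analyticLeaves_reMassed`, one (α)-currency lower): step leaves from §1 (pieces pinned), (1)₀ and no interaction at level 0 (their
`step0_reMassed`, `noInteraction0_seriesAC`), B15 (`bound46_reMassed_of_coreLTAtAC`), B20 (part 1's `logZT_le_reMassed_of_coreLTAtAC`), B21 (`LeavesCumAC.pprT_le_series_stdAC` at
`B′` with p608282's (25) at the chart centre `bound25_vac_coreLTAtAC`), B25 POINTWISE (`lf_reMassed_of_coreLTAtAC`). [cite: Balaban1985UV3, pp.256–274 (the leaves) + (46) p.267 + (65) p.273 + pp.273–274] -/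
theorem nonempty_analyticLeaves_reMassed_of_coreLTAtAC (R : RunAlphaEq324CoreLTAtAC 𝔊 𝔠 X 𝔖 𝔄 c) :
    Nonempty (UVStability3D.AnalyticLeaves { 𝔠.lane.consts with d := 𝔠.lane.consts.d + cm, d_nonneg := add_nonneg 𝔠.lane.consts.d_nonneg hcm } S
      (B'.withSeriesAC 𝔖 (piecesParamsOf S 𝔠.lane.carrier)).tower3.toTowerRun) := by
  have hsteps := fun k (hk : k + 1 ≤ S.K) => exists_stepLeaves_reMassed_of_coreLTAtAC hfam W' B' hB' hae hdom hWm hmt hk (R.steps k hk)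
  have hlf := lf_reMassed_of_coreLTAtAC hfam W' B' hB' hdom hcm hcap R
  have h46 := bound46_reMassed_of_coreLTAtAC hfam W' B' hB' R
  have hZT := fun k (hk : k + 1 ≤ S.K) => logZT_le_reMassed_of_coreLTAtAC W' B' hB' (R.steps k hk)
  have h0 := step0_reMassed W' B' hB' (𝔖 := 𝔖)
  subst hB'
  refine ⟨{ step0 := h0
            noInt0 := TowerBaseAC.noInteraction0_seriesAC _ 𝔖 _
            steps := fun k hk => (hsteps k hk).choose
            bound46 := h46
            logZT_le := fun k hk => ?_
            PprT_le := fun k hk => ?_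
            lf := hlf
            starT_eq := fun k hk => ?_
            logσ₀_le := fun k hk => ?_
            dg_le := fun k hk => ?_
            rem_eq := fun k hk => ?_ }⟩
  · rw [(hsteps k hk).choose_spec]; exact hZT k hk
  · have hk' : k + 1 ≤ S.K := hk
    rw [(hsteps k hk).choose_spec]
    exact LeavesCumAC.pprT_le_series_stdAC _ 𝔖 (piecesParamsOf S 𝔠.lane.carrier) k (by linarith [𝔠.kappa_ge]) 𝔠.C25_nonneg (by omega) (fun _ => 1)
      (bound25_vac_coreLTAtAC (R.steps k hk')) (Inputs.nblk_cube_le_sites 𝔠.lane k (by omega))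
  · rw [(hsteps k hk).choose_spec]; rfl
  · rw [(hsteps k hk).choose_spec]; exact le_rfl
  · rw [(hsteps k hk).choose_spec]; exact le_rfl
  · rw [(hsteps k hk).choose_spec]; rfl

end Summit.QuantumFields.YangMills.Theorems.BalabanUVNodesN08AlphaEq324RowACReMassedSlot

end
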